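import Summits.CriticalPhenomena.PercolationContinuityZ3.Theorems.Transplant.SkelConcRootKits
import Summits.CriticalPhenomena.PercolationContinuityZ3.Theorems.Transplant.SkelConcRootRadii
import Summits.CriticalPhenomena.PercolationContinuityZ3.Theorems.Transplant.SkelConcRootHop
import Summits.CriticalPhenomena.PercolationContinuityZ3.Theorems.Transplant.SkelRoom
import Summits.CriticalPhenomena.PercolationContinuityZ3.Theorems.Transplant.KNCellsBoxProdZ2ConcRootGB
import HarnessLib

/-!
# L6 (R), assembly: the ROOT RESIDUE of the concentric scheme of record `⟨Skel.cellGeomSG Φ C w₀ Λ, q, δc⟩`, RAW FORM — `Skel.rootOblA_of_rootRunSG`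
# (SkelConcRootRun) at the standard root run (`ca = 26t − m − 1`, `cb = 0`, `q' = 3t`, `rootRunOKN_std`) with the rim excess
# (`Skel.real_rim_le_rootSG`, SkelConcRootKits) and the first hop (`Skel.root_hsrcSG`, SkelConcRootHop; landing face
# `macroPiece c (6t) (ψ (6t)) (faceElt du.1 (sgUnit du))` on the start row, p3-g4's `SkelRoom`) DISCHARGED; what remains are the planar numerics,
# the radius facts, the count, the excess radius at the running parameter, the Lemma-9 link at the first-hop centre, and — until hp-8's L5.15
# `SkelConcKits` — the per-step kit clauses.  Generic twin of `KNCellsBoxProdZ2ConcRootReal.rootOblA_concG_raw`.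

builds on p205010 (kernel theorem, internal audit signed; external expert review pending) — nothing in this file uses p205010.
Status sentence (coordinator 2026-08-20T04:30Z): "θ(p_c) = 0 on ℤ^d, all d ≥ 2 — kernel-verified (Lean 4/Mathlib, standard axioms); internal
adversarial audit SIGNED 2026-08-20 04:29Z; external expert review pending."
Lane `prim-bschramm-*`, seat `prim-bschramm-p2` (gen 4; (R) = p2 lineage); helper file (`--supports stmt-CriticalPhenomena-4575`).

The first-hop centre is a vertex `c` over p3-g2's planar point `rootV du t m` (signed level `20t − m − 1`, transverse `−3t`; ‖·‖₁ ≤ 40t) reached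
by a wired step-walk (`root_hsrcSG`); its scale-`6t` prism has planar part in `C.Q 0 ∪ C.BtwN 0 du` (`root_hop_planarN`), hence lies in the cut
root world once its depth `40t + ψ(6t)` is one below `rQ 0 0` and `rB 0 0 du` and at most `Rt` (`win_rootQB_subset_rootUS`, step device); the
landing quarter-face has footprints on the start row `{level 26t − m − 1, |trans| ≤ 3t}` (`SkelRoom.φ_macroPiece_faceElt`, `mem_rootCore_zero`).
* `BoxProdZ2.root_hop_planarN`, `BoxProdZ2.rootV_norm_le`, `BoxProdZ2.rootV_mem_Q`;
* `Skel.win_rootQ_subset_rootUS`, `Skel.win_rootQB_subset_rootUS`;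
* **`Skel.rootOblA_concSG_raw`**.
[cite: KozmaNitzan2024, §4 p. 27 (G₀), p. 28 ((32) at the root), Lemma 9 (p. 16), Lemma 11 (pp. 22–23), Lemma 12 (p. 24)]
-/

noncomputable section

open MeasureTheory ProbabilityTheory
open scoped ENNReal Classical

namespace Summit.CriticalPhenomena.PercolationContinuityZ3.Theorems

namespace Transplant

/-! ## §1 Planar: the first-hop prism and the norm of its centre -/

namespace BoxProdZ2

open Literature.Probability.Percolation Literature.Probability.LatticeModels
open Literature.Probability.Percolation.KozmaNitzan
open Literature.Probability.Percolation.KozmaNitzan.Cells (oth oth_ne eq_oth_of_ne sgOf sgOf_sign stepVec_apply_fst stepVec_apply_oth)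

/-- **The planar part of the first-hop prism (scale `6t`) lies in `C.Q 0 ∪ C.BtwN 0 du`** (narrow between-box; `r = 4t`, `m + 1 ≤ 8t`, `1 ≤ t`).
[folklore] -/
theorem root_hop_planarN {C : PCells} {t : ℕ} (hr : (C.r : ℤ) = 4 * t) (du : MDir) {m : ℕ} (hm : m + 1 ≤ 8 * t) (ht : 1 ≤ t) {s : Site 2}
    (hs : s ∈ box 2 (6 * t)) : rootV du t m + s ∈ C.Q 0 ∪ C.BtwN 0 du := by
  have hz : s + rootV du t m ∈ (box 2 (6 * t)).image (fun s => s + rootV du t m) := Finset.mem_image.2 ⟨s, hs, rfl⟩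
  rw [add_comm]
  rcases root_hop_planar hr du hm ht hz with h | h
  · exact Finset.mem_union_left _ h
  · refine Finset.mem_union_right _ ?_
    rw [mem_box] at hs
    have hsb := hs (oth du.1)
    push_cast at hsb
    have ht' : (1 : ℤ) ≤ t := by exact_mod_cast ht
    rw [PCells.Btw, PCells.mem_psBox_iff] at h
    rw [PCells.BtwN, PCells.mem_psBox_iff]
    simp only [cen_zero_apply, sub_zero] at h ⊢
    refine ⟨h.1, ?_, ?_⟩
    · simp only [Pi.add_apply, rootV_oth]; linarith [hsb.1]
    · simp only [Pi.add_apply, rootV_oth]; linarith [hsb.2]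

/-- Each coordinate of `rootV du t m` has size `≤ 20t` (`m + 1 ≤ 20t`). [folklore] -/
theorem abs_rootV_le (du : MDir) (t m : ℕ) (hm : m + 1 ≤ 20 * t) (i : Fin 2) : |rootV du t m i| ≤ 20 * (t : ℤ) := by
  have hm' : (m : ℤ) + 1 ≤ 20 * t := by exact_mod_cast hm
  have hm0 : (0 : ℤ) ≤ m := by positivity
  by_cases hi : i = du.1
  · subst hi
    rw [rootV_fst, abs_le]
    rcases sgOf_sign du with h | h <;> rw [h] <;> constructor <;> linarith
  · rw [eq_oth_of_ne hi, rootV_oth, abs_le]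
    constructor <;> linarith

/-- `‖rootV du t m‖₁ ≤ 40t`. [folklore] -/
theorem rootV_norm_le (du : MDir) (t m : ℕ) (hm : m + 1 ≤ 20 * t) : (rootV du t m 0).natAbs + (rootV du t m 1).natAbs ≤ 40 * t := by
  have h0 := abs_rootV_le du t m hm 0
  have h1 := abs_rootV_le du t m hm 1
  rw [← Int.natCast_natAbs] at h0 h1
  omega

/-- `rootV du t m ∈ C.Q 0` (`r = 4t`, `m + 1 ≤ 17t`). [folklore] -/
theorem rootV_mem_Q {C : PCells} {t : ℕ} (hr : (C.r : ℤ) = 4 * t) (du : MDir) {m : ℕ} (hm : m + 1 ≤ 17 * t) : rootV du t m ∈ C.Q 0 := by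
  have h0 : (0 : Site 2) ∈ box 2 m := by rw [mem_box]; intro i; simp
  have h := root_seed_planar_subset_Q hr du hm (Finset.mem_image.2 ⟨0, h0, zero_add _⟩)
  exact h

end BoxProdZ2

/-! ## §2 Windows over the root cube / first-hop box inside the cut root world -/

namespace Skel

open Literature.Probability.Percolation Literature.Probability.LatticeModels SimpleGraph GadgetSystem ProbeHistory HSiteScheme Contour KNCells
open KNCells.KSchA PlanarSkeletonConc KNLevels
open Literature.Probability.Percolation.GM (HOct)
open Literature.Probability.Percolation.KozmaNitzan.Cells (sgOf sgOf_sign)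
open Literature.Barriers.CriticalPhenomena (graphBall mem_graphBall_self graphBall_mono)
open BoxProdZ2 (ConcRadiiG rootV rootV_fst rootV_oth sgUnit sgUnit_val RootRunOKN rootRunOKN_std root_hop_planarN rootV_norm_le rootV_mem_Q
  mem_rootCore_zero)

variable {V : Type} [DecidableEq V] {G : SimpleGraph V} [G.LocallyFinite] (Φ : PlanarSkeletonConc G)
variable {C : PCells} {w₀ : V} {Λ : ConcRadiiG} {q : unitInterval} {δc : ℝ}

/-- A window over `C.Q 0` of depth `R₀` with `R₀ + 1 ≤ rQ 0 0`, `R₀ ≤ Rt` lies in the cut root world (step device into the span `Q_0`). [folklore] -/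
theorem win_rootQ_subset_rootUS {R₀ Rt : ℕ} (hR₀Q : R₀ + 1 ≤ Λ.rQ 0 0) (hR₀t : R₀ ≤ Rt) (du : MDir) :
    Φ.Win w₀ (C.Q 0) R₀ ⊆ rootUS Φ C w₀ Λ q δc Rt du := by
  intro v hv
  obtain ⟨hd, hφv⟩ := Φ.mem_Win.1 hv
  refine Finset.mem_filter.2 ⟨Finset.mem_union_left _ ?_, graphBall_mono G w₀ hR₀t hd⟩
  change v ∈ Φ.VWin w₀ (C.Q 0) (Λ.rQ 0 0)
  exact Φ.mem_VWin_of_zdAdj hd hR₀Q hφv (C.exists_adj_of_mem_Q _ hφv)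

/-- A window over `C.Q 0 ∪ C.BtwN 0 du` of depth `D` with `D + 1 ≤ rQ 0 0`, `D + 1 ≤ rB 0 0 du`, `D ≤ Rt` lies in the cut root world. [folklore] -/
theorem win_rootQB_subset_rootUS {D Rt : ℕ} (du : MDir) (hDQ : D + 1 ≤ Λ.rQ 0 0) (hDB : D + 1 ≤ Λ.rB 0 0 du) (hDt : D ≤ Rt) :
    Φ.Win w₀ (C.Q 0 ∪ C.BtwN 0 du) D ⊆ rootUS Φ C w₀ Λ q δc Rt du := by
  intro v hv
  obtain ⟨hd, hφv⟩ := Φ.mem_Win.1 hv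
  refine Finset.mem_filter.2 ⟨?_, graphBall_mono G w₀ hDt hd⟩
  rcases Finset.mem_union.1 hφv with h | h
  · refine Finset.mem_union_left _ ?_
    change v ∈ Φ.VWin w₀ (C.Q 0) (Λ.rQ 0 0)
    exact Φ.mem_VWin_of_zdAdj hd hDQ h (C.exists_adj_of_mem_Q _ h)
  · refine Finset.mem_union_right _ (Finset.mem_union_left _ ?_)
    change v ∈ Φ.VWin w₀ (C.BtwN 0 du) (Λ.rB 0 0 du)
    exact Φ.mem_VWin_of_zdAdj hd hDB h (C.exists_adj_of_mem_BtwN 0 du h)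

/-! ## §3 The raw root theorem -/

/-- **THE ROOT RESIDUE OF THE CONCENTRIC SCHEME OF RECORD, RAW FORM** (history-free hypotheses; kit clauses still a hypothesis): `Skel.RootOblA`
for `⟨Skel.cellGeomSG Φ C w₀ Λ, q, δc⟩` from, per direction, the standard planar root run (`r = 4t`, `R' + ℓ₀ ≤ t`, `100 R' ≤ t`,
`m + 47 R' + 2 ≤ t`), the radius facts (`Rt + 1 ≤ rB 0 0 du / rQ 0 (0+du) / rM 0 (0+du)`, `60 r ≤ Rt`), the cube depth `rQ 0 0 ≤ E₀'`, the counts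
at accuracy `δr 44`, the excess radius `R₁ ≤ Rt − L'` at the running parameter (entrances at depth `E₀' + 1`, habitats of planar diameter
`mex ≥ 60 r`), the first-hop data (`40t ≤ R₀`, `R₀ + 1 ≤ rQ 0 0`, `R₀ ≤ Rt`, depth of the scale-`6t` prism `40t + ψ(6t)` one below `rQ 0 0` and
`rB 0 0 du` and `≤ Rt`) with its Lemma-9 link at the centre, and the per-step kit clauses. [cite: KozmaNitzan2024, §4 p. 28 ((32) at the root), Lemma 11] -/
theorem rootOblA_concSG_raw [Countable V] (hΛ : WFS C Λ) (hφ : Φ.φ w₀ = 0) {p : unitInterval} (hC : Φ.toPlanarSkeleton.CylSubcritical p)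
    {Δ' : ℕ} {δr : ℕ → ℝ} {Rt L' t R' ℓ₀ Rlev N j₀ j₁ m E₀' mex R₁ R₀ : ℕ}
    -- planar numerics of the standard root run
    (hr : (C.r : ℤ) = 4 * t) (hs : (R' : ℤ) + ℓ₀ ≤ t) (h100 : 100 * R' ≤ t) (hm : m + 47 * R' + 2 ≤ t) (ht : 1 ≤ t)
    (hRl : Rlev + 1 ≤ R') (hj : j₁ ≤ Rlev)
    (P : MDir → WinAdvData V)
    (hP : ∀ du, P du = rootWAD Φ w₀ Rt L' du t R' ℓ₀ (26 * (t : ℤ) - m - 1) 0 (3 * (t : ℤ)) Rlev N j₀ j₁ (rootUS Φ C w₀ Λ q δc Rt du))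
    -- radius facts
    (hRB : ∀ du, Rt + 1 ≤ Λ.rB 0 0 du) (hRQ : ∀ du, Rt + 1 ≤ Λ.rQ 0 ((0 : Site 2) + stepVec du))
    (hRM : ∀ du, Rt + 1 ≤ Λ.rM 0 ((0 : Site 2) + stepVec du)) (hRt : 60 * C.r ≤ Rt) (hQ0 : Λ.rQ 0 0 ≤ E₀')
    -- counts and kits
    (hcount : 1 / (1 - (q : ℝ)) ^ (Δ' * N) ≤ δr 44 * ((Finset.Icc j₀ j₁).card : ℝ))
    (hkits : ∀ du, ∀ k ≤ (P du).nA, ∀ j ∈ Finset.Icc (P du).j₀ (P du).j₁, ∃ (σ : KNLevels.SData V) (Sz : Finset V),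
      KNLevels.SHyp (winLData Φ (P du).root (P du).Rπ ((P du).alo k) ((P du).ahi k) (P du).root (P du).Sfin) j σ ∧ σ.N ≤ (P du).N ∧
      (1 - (q : ℝ) ^ σ.sB) ^ σ.k ≤ δr (P du).nA ∧
      Sz ⊆ (winLData Φ (P du).root (P du).Rπ ((P du).alo k) ((P du).ahi k) (P du).root (P du).Sfin).X j ∧ Sz ⊆ (P du).stepD Φ k ∧
      (∀ x ∈ σ.K, ∀ e' ∈ σ.seed x, e' ∉ wireSet (↑Sz : Set V)) ∧ (∀ x ∈ σ.K, σ.face x ⊆ Sz) ∧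
      (∀ x ∈ σ.K, 1 - 3 * δr (P du).nA ≤ (prodBernoulli ((⟨cellGeomSG Φ C w₀ Λ, q, δc⟩ : KSchA V ℕ).W0sub G
          (rootUS Φ C w₀ Λ q δc Rt du))).real {ω | ∃ u ∈ σ.face x,
        1 - δr (P du).nA < (prodBernoulli (pinW ((⟨cellGeomSG Φ C w₀ Λ, q, δc⟩ : KSchA V ℕ).W0sub G (rootUS Φ C w₀ Λ q δc Rt du))
          (wireSet (↑Sz : Set V)) ω)).real
          (⋃ t' ∈ (P du).coreE Φ k, openConnIn (↑((P du).stepD Φ k) : Set V) u t')}))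
    -- the rim excess: an excess radius at the running parameter
    {η : ℝ} (hη : η ≤ δr 44 / 2) (hmex : 60 * C.r ≤ mex)
    (hR₁ : ∀ R'', R₁ ≤ R'' → ∀ (Rw : ℕ) (D' A' : Finset V), (∀ d ∈ D', d ∈ graphBall G w₀ Rw) →
      (∀ d ∈ D', ∀ d' ∈ D', Φ.φ d - Φ.φ d' ∈ box 2 mex) → A' ⊆ D' → (∀ a ∈ A', a ∈ graphBall G w₀ (E₀' + 1)) →
        (bondPercolation G q).real (excess G w₀ R'' D' A') ≤ η)
    (hR : R₁ ≤ Rt - L')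
    -- the first hop: the window over the root cube, the prism depth, the link at the centre
    (h40 : 40 * t ≤ R₀) (hR₀Q : R₀ + 1 ≤ Λ.rQ 0 0) (hR₀t : R₀ ≤ Rt)
    (hDQ : 40 * t + fatRadius Φ hC (6 * t) + 1 ≤ Λ.rQ 0 0) (hDB : ∀ du, 40 * t + fatRadius Φ hC (6 * t) + 1 ≤ Λ.rB 0 0 du)
    (hDt : 40 * t + fatRadius Φ hC (6 * t) ≤ Rt)
    (hlink : ∀ du (c : V), Φ.φ c = rootV du t m → c ∈ graphBall G w₀ ((rootV du t m 0).natAbs + (rootV du t m 1).natAbs) →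
      ∃ k, fatSeq Φ hC c k ⊆ Φ.Win w₀ (C.Q 0) R₀ ∧ 1 - δr 44 < (bondPercolation G q).real
        (linkIn (↑(fatSeq Φ hC c (6 * t))) (fatSeq Φ hC c k) (macroPiece Φ c (6 * t) (fatRadius Φ hC (6 * t)) (faceElt du.1 (sgUnit du))))) :
    RootOblA Φ (⟨cellGeomSG Φ C w₀ Λ, q, δc⟩ : KSchA V ℕ) Δ' δr := by
  set S : KSchA V ℕ := ⟨cellGeomSG Φ C w₀ Λ, q, δc⟩ with hSdef
  have hmt : m + 1 ≤ 8 * t := by omega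
  have hOK : ∀ du : MDir, RootRunOKN C t R' ℓ₀ (26 * (t : ℤ) - m - 1) 0 (3 * (t : ℤ)) := fun _ => rootRunOKN_std hr hs h100 hm
  have hnA : ∀ du, (P du).nA = 44 := fun du => by rw [hP]; rfl
  have hnorm : ∀ du, (rootV du t m 0).natAbs + (rootV du t m 1).natAbs ≤ 40 * t := fun du => rootV_norm_le du t m (by omega)
  -- the first hop, per direction: a centre over `rootV`, inside the ball of radius `40t`, with its landing face certified
  have hhop : ∀ du : MDir, ∃ c : V, Φ.φ c = rootV du t m ∧ c ∈ graphBall G w₀ (40 * t) ∧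
      1 - δr 44 < (prodBernoulli (S.W0sub G (rootUS Φ C w₀ Λ q δc Rt du))).real
        (⋃ t' ∈ macroPiece Φ c (6 * t) (fatRadius Φ hC (6 * t)) (faceElt du.1 (sgUnit du)), openConn w₀ t') := by
    intro du
    -- the prism lies in the cut root world: depth `≤ 40t + ψ(6t)`, footprint in `C.Q 0 ∪ C.BtwN 0 du`
    have hℓU : ∀ c : V, Φ.φ c = rootV du t m → c ∈ graphBall G w₀ ((rootV du t m 0).natAbs + (rootV du t m 1).natAbs) →
        fatSeq Φ hC c (6 * t) ⊆ rootUS Φ C w₀ Λ q δc Rt du := by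
      intro c hφc hcb
      refine subset_trans (fatSeq_subset_Win Φ hC (w₀ := w₀) (R' := 40 * t + fatRadius Φ hC (6 * t)) (P := C.Q 0 ∪ C.BtwN 0 du) ?_ ?_)
        (win_rootQB_subset_rootUS Φ du hDQ (hDB du) hDt)
      · intro v hv
        exact BoxProdZ2.mem_graphBall_add G (graphBall_mono G w₀ (hnorm du) hcb) hv
      · intro y hy
        rw [hφc]
        exact root_hop_planarN hr du hmt ht hy
    obtain ⟨c, hφc, hcb, hsrc⟩ := root_hsrcSG Φ C w₀ (Λ := Λ) hφ (q := q) (δc := δc) hC (U' := rootUS Φ C w₀ Λ q δc Rt du)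
      (rootV_mem_Q hr du (by omega)) (R₀ := R₀) (le_trans (Nat.le_succ _) hR₀Q) (win_rootQ_subset_rootUS Φ hR₀Q hR₀t du)
      (ℓ := 6 * t) (δ := δr 44) (g := faceElt du.1 (sgUnit du)) (hlink du) ((hnorm du).trans h40) hℓU
    exact ⟨c, hφc, graphBall_mono G w₀ (hnorm du) hcb, hsrc⟩
  choose c hcφ hcb hsrc using hhop
  refine rootOblA_of_rootRunSG Φ C w₀ hΛ hφ q δc hOK hRl hj P (fun du => by rw [hP]; rfl) hRB hRQ hRM hRt
    (fun du => by rw [hP]; exact hcount) hkits (η := η) (fun du => by rw [hnA]; exact hη) (fun du k hk => ?_)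
    (B₀ := fun du => macroPiece Φ (c du) (6 * t) (fatRadius Φ hC (6 * t)) (faceElt du.1 (sgUnit du)))
    (Bpl := fun du => (P du).acore 0) (fun du => ?_) (fun du => subset_rfl) (fun du => by rw [hnA]; exact hsrc du)
  · -- the rim excess
    rw [hP] at hk ⊢
    exact real_rim_le_rootSG Φ hΛ hφ (hOK du) (hRB du) (hRQ du) hQ0 hmex hR₁ hR hk
  · -- the landing face lies over the start row, within depth `Rt`
    refine macroPiece_faceElt_subset_Win Φ (fun v hv => graphBall_mono G w₀ hDt (BoxProdZ2.mem_graphBall_add G (hcb du) hv)) ?_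
    intro z h1 h2 h3
    rw [hP]
    change z ∈ ChainPlanar.Adv.core 0 (3 * (t : ℤ)) (t : ℤ) R' du.1 (sgOf du) (BoxProdZ2.rootCtr du (26 * (t : ℤ) - m - 1) 0) 0
    rw [mem_rootCore_zero]
    rw [hcφ du] at h1 h2 h3
    rw [rootV_fst, sgUnit_val] at h1
    rw [rootV_oth] at h2 h3
    have hσσ : sgOf du * sgOf du = 1 := by rcases sgOf_sign du with h | h <;> simp [h]
    refine ⟨?_, ?_, ?_⟩
    · rw [h1]
      have : sgOf du * (sgOf du * (20 * (t : ℤ) - m - 1) + sgOf du * ((6 * t : ℕ) : ℤ)) =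
          sgOf du * sgOf du * (20 * (t : ℤ) - m - 1 + ((6 * t : ℕ) : ℤ)) := by ring
      rw [this, hσσ, one_mul]; push_cast; ring
    · linarith
    · push_cast at h3 ⊢; linarith

end Skel

end Transplant

end Summit.CriticalPhenomena.PercolationContinuityZ3.Theorems

end
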